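import Summits.AtomisticToContinuum.Crystallization.Theorems.FrustratedLawDichotomyStrainedPatchHomEntryFitHcpMinPairs

/-!
# The hcp fit theorem WITH A ROTATION PAYLOAD (real side): pair fit against `R (nbr k)` for any linear isometry `R`, minimising scales only
# (27623 `(H) HomFloor (1/625)`, hcp half; hand-1 g31 FINDING §5 «rotation payload = the last misfit lever»; critic rows 1172 / 1175 «rotation iff needed»)

decomp-a2c hand-1 g31 (crux `AperiodicFrustratedLawGap`, stmt-AtomisticToContinuum-27623).  `…HomEntryFitHcpMinPairs.goodAtScale_of_fitBounds_hcp_eta_min`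
compares the deformed neighbours `nbrU U ξ k` with the FIXED pattern directions `nbr k` (identity rotation); the crux's criterion `Gy` allows any linear isometry.
KERNEL/FLOAT FINDING (hand-1 g31): at the in-slab misfit extreme of the crossover cells the rotation-optimal nearest-`d` misfit is `≈ 0.0016` below the
identity-rotation value (`.0477` vs `.0493` at `0.94 t_b`) — the margin that would take the crossover cell from `2⁻¹³` back to `2⁻¹²` and the model budget from
`2.0e5` to `5.2e4` core-h.  This file is the def-free real theorem the rotation kit needs:

* ★★ `goodAtScale_of_fitBounds_hcp_eta_minR (R : E3 →ₗᵢ[ℝ] E3) …` — `…_min` verbatim with `hfit : … ‖nbrU k − ‖nbrU k′‖ • R (nbr k)‖² ≤ η′² d2lo` and the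
  isometry `R.comp A` (`A` = `exists_hcpIso`) passed to `…HomPrunesFit.goodAtScale_centre_of_fit_hcpPattern`.
The kernel side (g32): a rational Cayley matrix `Q` (`Qᵀ Q = 1` by `norm_num`) made an isometry by `…HomOrthogonal.exists_linearIsometry_of_orthogonal`,
the rotated pattern intervals `Σ_j Q_ij (nbr k)_j`, and `fitOKHDM` with them in place of `nbrFI` (`fitOKHDMR`), soundness through this theorem.

Def-free; 0 sorry; standard axioms; no instances / notation / `#eval`.  `--supports stmt-AtomisticToContinuum-27623`.
-/


noncomputable section

namespace Summit.AtomisticToContinuum.Crystallization.Theorems.FrustratedLawDichotomyStrainedPatchHomEntryFitHcpCentred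

open scoped BigOperators RealInnerProductSpace
open Literature.Analysis.ValidatedNumerics.Numerics
open Literature.Geometry.DiscreteGeometry (hcpKissingPattern)
open Literature.Geometry.DiscreteGeometry.ShellCensus (hcpTuple hcpTuple_injective)
open Summit.AtomisticToContinuum.Crystallization.Theorems.ChargedEnergyGapNegative (E3)
open Summit.AtomisticToContinuum.Crystallization.Theorems.FrustratedLawDichotomySchurCut (effPot w₄₅ ω₄)
open Summit.AtomisticToContinuum.Crystallization.Theorems.FrustratedLawDichotomyMotifLemmas (GoodAtScale)
open Summit.AtomisticToContinuum.Crystallization.Theorems.FrustratedLawDichotomyAveragingRuleTightFree (TightNearCap BadNearCap)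
open Summit.AtomisticToContinuum.Crystallization.Theorems.FrustratedLawDichotomyExemptAbsorption (ExemptNear)
open Summit.AtomisticToContinuum.Crystallization.Theorems.FrustratedLawDichotomyStrainedPatchHomSplit
open Summit.AtomisticToContinuum.Crystallization.Theorems.FrustratedLawDichotomyStrainedPatchHomGram (norm_sq_latPt_eq_sum_gram norm_sq_latPt_add_eq_sum_gram)
open Summit.AtomisticToContinuum.Crystallization.Theorems.FrustratedLawDichotomyStrainedPatchHomLatticeBox (norm_apply_ge_of_near_one latPt_zero)
open Summit.AtomisticToContinuum.Crystallization.Theorems.FrustratedLawDichotomyStrainedPatchHomLatticeBoxHcp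
  (latPt_eq_apply_one shifted_eq_apply mem_box_of_norm_hexPt_lt mem_box_of_norm_hexPt_add_shift_lt)
open Summit.AtomisticToContinuum.Crystallization.Theorems.FrustratedLawDichotomyStrainedPatchHomPrunesFit (goodAtScale_centre_of_fit_hcpPattern)
open Summit.AtomisticToContinuum.Crystallization.Theorems.FrustratedLawDichotomyAveragingCut (self_mem_ball)
open Summit.AtomisticToContinuum.Crystallization.Theorems.FrustratedLawDichotomyStrainedPatchHomPrunes (locHom_hcp_centre)
open Summit.AtomisticToContinuum.Crystallization.Theorems.FrustratedLawDichotomyStrainedPatchHomPrunedPolar (homFloor_of_prunedBoxSums_selfAdjoint)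
open Summit.AtomisticToContinuum.Crystallization.Theorems.FrustratedLawDichotomyStrainedPatchHomLeafCheckC (iccC iccC_eq)
open Summit.AtomisticToContinuum.Crystallization.Theorems.FrustratedLawDichotomyStrainedPatchHomCertTree (CertTree treeOK)
open Summit.AtomisticToContinuum.Crystallization.Theorems.FrustratedLawDichotomyStrainedPatchHomEntryGram
open Summit.AtomisticToContinuum.Crystallization.Theorems.FrustratedLawDichotomyStrainedPatchHomEntryFitKit (lmin lmin_le_of_mem lmin_mem)
open Summit.AtomisticToContinuum.Crystallization.Theorems.FrustratedLawDichotomyStrainedPatchHomEntryFit (scaleL devFI entryLeafOKF fccHalf_of_entryFitTree lmax le_lmax_of_mem)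
open Summit.AtomisticToContinuum.Crystallization.Theorems.FrustratedLawDichotomyStrainedPatchHomEntryGramHcp
open Summit.AtomisticToContinuum.Crystallization.Theorems.FrustratedLawDichotomyStrainedPatchHomEntryHcpFrame
open Summit.AtomisticToContinuum.Crystallization.Theorems.FrustratedLawDichotomyTwoShellRigidityAssemblyDial (hcpTuple_mem exists_hcpTuple_eq)
open Summit.AtomisticToContinuum.Crystallization.Theorems.FrustratedLawDichotomyStrainedPatchHomLatticeBoxHcp (latPt_eq_apply_one)
open Summit.AtomisticToContinuum.Crystallization.Theorems.FrustratedLawDichotomyStrainedPatchHomEntryFit (scaleL devFI lmax le_lmax_of_mem)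
open Summit.AtomisticToContinuum.Crystallization.Theorems.FrustratedLawDichotomyStrainedPatchHomEntryFitHcpKit
open Summit.AtomisticToContinuum.Crystallization.Theorems.FrustratedLawDichotomyStrainedPatchHomEntryFitHcp
open Summit.AtomisticToContinuum.Crystallization.Theorems.FrustratedLawDichotomyStrainedPatchHomEntrySearch
open Summit.AtomisticToContinuum.Crystallization.Theorems.FrustratedLawDichotomyStrainedPatchHomEntrySign (entryLeafOKD fccHalf_of_entrySearchDom)
open Summit.AtomisticToContinuum.Crystallization.Theorems.FrustratedLawDichotomyStrainedPatchHomEntryFitHcpSharpKit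
open Summit.AtomisticToContinuum.Crystallization.Theorems.FrustratedLawDichotomyStrainedPatchHomEntryFitHcpSharp

open Summit.AtomisticToContinuum.Crystallization.Theorems.FrustratedLawDichotomyStrainedPatchHomEntryFitHcpSharpEta
open Summit.AtomisticToContinuum.Crystallization.Theorems.FrustratedLawDichotomyStrainedPatchHomPrunedPolar (homFloor_of_prunedBoxSums_selfAdjoint)
open Summit.AtomisticToContinuum.Crystallization.Theorems.FrustratedLawDichotomyStrainedPatchHomEntryGram (rootC rootW)
open Summit.AtomisticToContinuum.Crystallization.Theorems.FrustratedLawDichotomyStrainedPatchHomEntryGramHcp (rootCH rootWH)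
open Summit.AtomisticToContinuum.Crystallization.Theorems.FrustratedLawDichotomyStrainedPatchHomEntryTable (muRec muRec_ok)
open Summit.AtomisticToContinuum.Crystallization.Theorems.FrustratedLawDichotomyStrainedPatchHomEntryTableP (entryLeafOK6RBKP)
open Summit.AtomisticToContinuum.Crystallization.Theorems.FrustratedLawDichotomyStrainedPatchHomEntryTreeCert (fccHalf_of_entryTree6RBKP)
open Summit.AtomisticToContinuum.Crystallization.Theorems.FrustratedLawDichotomyStrainedPatchHomEntryFlipHcp (HcpDich hcpHalf_of_entryTreeShuf)
open Summit.AtomisticToContinuum.Crystallization.Theorems.FrustratedLawDichotomyStrainedPatchHomEntrySymBox (symH hbox_symU)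
open Summit.AtomisticToContinuum.Crystallization.Theorems.FrustratedLawDichotomyStrainedPatchHomEntryQuickHcp (entryLeafOKHQ entryLeafOKHQ_imp)
open Summit.AtomisticToContinuum.Crystallization.Theorems.FrustratedLawDichotomyStrainedPatchHomLeafTableCheckHcpV (entryLeafOKHVK_sound)
open Summit.AtomisticToContinuum.Crystallization.Theorems.FrustratedLawDichotomyStrainedPatchHomCurvLeafHCC (entryLeafOKHCCX entryLeafOKHCCX_sound)
open Summit.AtomisticToContinuum.Crystallization.Theorems.FrustratedLawDichotomyStrainedPatchHomEntryLeafHT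
  (HTCert entryLeafOKHT4 entryLeafOKHT4_sound)
open Summit.AtomisticToContinuum.Crystallization.Theorems.FrustratedLawDichotomyStrainedPatchHomEntryFitTolerance (cT090 cT095 wU12X12 wU11X11)

/-! ## The real fit theorem with a rotation payload -/

/-- ★★ **CENTRE `1/20`-GOOD (hcp PATTERN) FROM FIT BOUNDS AGAINST A ROTATED PATTERN `R (nbr k)`, MINIMISING SCALES ONLY** (`R` any linear isometry;
`…_min` verbatim with the composite isometry `R.comp A`). [folklore] -/
theorem goodAtScale_of_fitBounds_hcp_eta_minR (R : E3 →ₗᵢ[ℝ] E3) (U : E3 →L[ℝ] E3) (ξ : E3) (hU : ‖U - 1‖ ≤ 1 / 4) (hξ : ‖ξ‖ ≤ 1 / 2) {η' : ℝ} (hη'0 : 0 ≤ η')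
    (hη' : η' < 1 / 20) {dlo dhi : ℝ} (hdlo : 0 < dlo)
    (hdhi : dhi ≤ 3 / 2)
    (hlo : ∀ k, dlo ≤ ‖nbrU U ξ k‖) (hhi : ∃ k, ‖nbrU U ξ k‖ ≤ dhi) {d2lo : ℝ} (hd2 : ∀ k, d2lo ≤ ‖nbrU U ξ k‖ ^ 2)
    (hfit : ∀ k k', (∀ j, ‖nbrU U ξ k'‖ ≤ ‖nbrU U ξ j‖) → ‖nbrU U ξ k - ‖nbrU U ξ k'‖ • R (nbr k)‖ ^ 2 ≤ η' ^ 2 * d2lo)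
    (hcl : ∀ k, ‖nbrU U ξ k‖ ≤ 13 / 10 * dlo - 1 / 100)
    (hfarA : ∀ b ∈ (Fintype.piFinset fun _ : Fin 3 => Finset.Icc (-7 : ℤ) 7), b ≠ 0 → (∀ k, hshift k = false → hlab k ≠ b) →
      13 / 10 * dhi + 1 / 100 ≤ ‖latPt U hexFrame b‖)
    (hfarB : ∀ b ∈ (Fintype.piFinset fun _ : Fin 3 => Finset.Icc (-7 : ℤ) 7), (∀ k, hshift k = true → hlab k ≠ b) →
      13 / 10 * dhi + 1 / 100 ≤ ‖latPt U hexFrame b + U (hcpShift + ξ)‖) :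
    ∀ (M : ℕ) (z : Fin M → E3) (c : Fin M), Function.Injective z →
      (∀ x : E3, dist x (z c) < 15 / 2 → (x ∈ Set.range z ↔
        x - z c ∈ {v : E3 | ∃ b : Fin 3 → ℤ, v = latPt U hexFrame b ∨ v = latPt U hexFrame b + U (hcpShift + ξ)})) →
      GoodAtScale (1 / 20) (3 / 2) z c := by
  intro M z c _hz hT
  obtain ⟨k₀, -, hk₀⟩ := Finset.exists_min_image Finset.univ (fun k : Fin 12 => ‖nbrU U ξ k‖) Finset.univ_nonempty
  have hd_le : ∀ k, ‖nbrU U ξ k₀‖ ≤ ‖nbrU U ξ k‖ := fun k => hk₀ k (Finset.mem_univ k)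
  have hdlo_d : dlo ≤ ‖nbrU U ξ k₀‖ := hlo k₀
  have hd_dhi : ‖nbrU U ξ k₀‖ ≤ dhi := by obtain ⟨k, hk⟩ := hhi; exact (hd_le k).trans hk
  have hd0 : 0 < ‖nbrU U ξ k₀‖ := hdlo.trans_le hdlo_d
  obtain ⟨A, hA⟩ := exists_hcpIso
  -- the index of a pattern point
  have hk : ∀ u : ↥hcpKissingPattern, ∃ k : Fin 12, hcpTuple k = (u : E3) := fun u => exists_hcpTuple_eq u.2
  choose kOf hkOf using hk
  -- both families are short only on the twelve labels
  have hshortA : ∀ b : Fin 3 → ℤ, latPt U hexFrame b ≠ 0 → ‖latPt U hexFrame b‖ < 13 / 10 * ‖nbrU U ξ k₀‖ + 1 / 100 →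
      ∃ k, hshift k = false ∧ hlab k = b := by
    intro b hb0 hlt
    by_cases hex : ∃ k, hshift k = false ∧ hlab k = b
    · exact hex
    · exfalso
      have hb : b ≠ 0 := by rintro rfl; exact hb0 (latPt_zero U hexFrame)
      have h34 := norm_apply_ge_of_near_one hU (latPt 1 hexFrame b)
      rw [← latPt_eq_apply_one] at h34
      have hbox := mem_box_of_norm_hexPt_lt (b := b) (by linarith)
      have := hfarA b hbox hb (fun k hk he => hex ⟨k, hk, he⟩)
      linarith
  have hshortB : ∀ b : Fin 3 → ℤ, ‖latPt U hexFrame b + U (hcpShift + ξ)‖ < 13 / 10 * ‖nbrU U ξ k₀‖ + 1 / 100 →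
      ∃ k, hshift k = true ∧ hlab k = b := by
    intro b hlt
    by_cases hex : ∃ k, hshift k = true ∧ hlab k = b
    · exact hex
    · exfalso
      have h34 := norm_apply_ge_of_near_one hU (latPt 1 hexFrame b + hcpShift + ξ)
      rw [← shifted_eq_apply] at h34
      have htri : ‖latPt 1 hexFrame b + hcpShift‖ ≤ ‖latPt 1 hexFrame b + hcpShift + ξ‖ + ‖ξ‖ := by
        have := norm_sub_le (latPt 1 hexFrame b + hcpShift + ξ) ξ
        simpa using this
      have hbox := mem_box_of_norm_hexPt_add_shift_lt (b := b) (by linarith)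
      have := hfarB b hbox (fun k hk he => hex ⟨k, hk, he⟩)
      linarith
  refine goodAtScale_centre_of_fit_hcpPattern hT (d := ‖nbrU U ξ k₀‖) (η' := η') (γ := 1 / 100) (A := R.comp A)
    (t' := fun u => nbrU U ξ (kOf u)) (hd_dhi.trans hdhi) hd0 (by norm_num) hη' (by linarith) ?_ ?_ ?_ ?_
  · -- (hfit)
    intro u
    refine ⟨nbrU_mem U ξ (kOf u), by linarith [hcl (kOf u), hlo (kOf u)], ?_⟩
    have g := hfit (kOf u) k₀ hd_le
    have h2 := hd2 k₀
    have hsq : ‖nbrU U ξ (kOf u) - ‖nbrU U ξ k₀‖ • R (nbr (kOf u))‖ ^ 2 ≤ (η' * ‖nbrU U ξ k₀‖) ^ 2 := by rw [mul_pow]; nlinarith [sq_nonneg η']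
    show ‖nbrU U ξ (kOf u) - ‖nbrU U ξ k₀‖ • (R.comp A) (u : E3)‖ ≤ η' * ‖nbrU U ξ k₀‖
    rw [LinearIsometry.coe_comp, Function.comp_apply, ← hkOf u, hA]
    exact (abs_le_of_sq_le_sq' hsq (mul_nonneg hη'0 (norm_nonneg _))).2
  · -- (hlow)
    rintro w ⟨b, hb⟩ hw0 hlt
    rcases hb with rfl | rfl
    · obtain ⟨k, hk, rfl⟩ := hshortA b hw0 hlt
      rw [← nbrU_of_unshifted (U := U) (ξ := ξ) hk]; exact hd_le k
    · obtain ⟨k, hk, rfl⟩ := hshortB b hlt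
      rw [← nbrU_of_shifted (U := U) (ξ := ξ) hk]; exact hd_le k
  · -- (hex)
    refine ⟨nbrU U ξ k₀, nbrU_mem U ξ k₀, fun h0 => ?_, le_rfl⟩
    rw [h0, norm_zero] at hd0
    exact lt_irrefl _ hd0
  · -- (hclean)
    rintro w ⟨b, hb⟩ hw0 hlt
    have key : ∀ k, w = nbrU U ξ k → ‖w‖ ≤ 13 / 10 * ‖nbrU U ξ k₀‖ - 1 / 100 ∧ w ∈ Set.range (fun u : ↥hcpKissingPattern => nbrU U ξ (kOf u)) := by
      rintro k rfl
      refine ⟨by linarith [hcl k], ⟨⟨hcpTuple k, hcpTuple_mem k⟩, ?_⟩⟩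
      have e : kOf ⟨hcpTuple k, hcpTuple_mem k⟩ = k := hcpTuple_injective (hkOf ⟨hcpTuple k, hcpTuple_mem k⟩)
      simp only [e]
    rcases hb with rfl | rfl
    · obtain ⟨k, hk, rfl⟩ := hshortA b hw0 hlt
      exact key k (nbrU_of_unshifted hk).symm
    · obtain ⟨k, hk, rfl⟩ := hshortB b hlt
      exact key k (nbrU_of_shifted hk).symm

end Summit.AtomisticToContinuum.Crystallization.Theorems.FrustratedLawDichotomyStrainedPatchHomEntryFitHcpCentred

end
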